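import Summits.QuantumFields.YangMills.Theorems.BalabanUVNodesPortS1G3CLocOps
import Summits.QuantumFields.YangMills.Theorems.BalabanUVNodesPortS1G3CDefsL
import Summits.QuantumFields.YangMills.Theorems.BalabanUVNodesPortS1G3CPieceSum
import Summits.QuantumFields.YangMills.Theorems.BalabanUVNodesPortS1LZdetGeom
import Literature.MathematicalPhysics.QuantumFieldTheory.Balaban1983to89.B3Taylor310LocalRemainder

/-!
# NODE O port PT-A — `stub_G3C` (repaired edition `G3CAtRecordL`), layer (D1b): BOUNDS FOR THE X-LOCALIZED OPERATORS AND THE LOCAL INVERSES — the `e^{δ₁·tdist}`-weighted Schur sums of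
# `T^{(Z)}(φ)` are `≤ c₀·K₀(64,8)` on the record space of `Z` (from (P4-lat) + (1.26)), hence the LATTICE-SCALE COMBES–THOMAS DECAY of the local inverse
# `‖G_Z(x, φ) i j‖ ≤ e^{−κ·tdist(i,j)}/(γ₀/2)`, UNIFORMLY in `x ≥ 0`, the volume and `Z` — the «decay across one cube» that drives the repaired road (memo §5b (ii))

Cell `ym-nodeO-ideate`, porter hand `hand-27930-G3C` (g0); proof kind, `--supports stmt-QuantumFields-27930 --as helper`; count-neutral.  [B9] = [Balaban1985BackgroundPropagators], [16] = [Balaban1985UV3],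
[I] = [Balaban1987RG1], [II] = [Balaban1988RG2Cluster].

WHY.  Layer (D1) (✓`…PortS1G3CLocOps`) typed `T^{(Z)} = Σ_{Y⊆Z} T_Y`, the restricted resolvent block and the local inverse `G_Z`, with coercivity∕unit∕`1/γ₀`∕continuity from `P0CarrierClauses`.  This
layer adds what (P4-lat) (`P0CarrierLatticeDecay`, ✓`…PortS1G3CDefsL`) buys: by ▶ PTA-1's cube map (✓`…LZdetGeom.fluct_supp_of_cube`: the letter's `domSites` support ⟹ cube support) and the
hand's (1.26) brick (✓`G3CGeom.weightedRowSum_sum_pieces_le`), the weighted Schur sums of `T^{(Z)}(φ)` at `φ ∈ U^c(Z)` (each `Y ⊆ Z` is read at `φ ∈ U^c(Y) ⊇ U^c(Z)`,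
✓`K0RecordFormatNames.recordUc_antitone`) are `≤ c₀·K₀(4·2^4, 2·4)` as soon as `δ₀ ≥ kappa₀(64,8)`; feeding the x-uniform accretive Combes–Thomas (✓`G3CCT.norm_resolvent_apply_le_of_weightedSchur`,
pseudo-metric `tdist` on the level-`k` sources: ✓`B3Taylor310LocalRemainder.tdist_self∕comm∕triangle`) gives the entrywise decay of `G_Z(x, φ)` at every rate `κ` with `2κ ≤ δ₁`,
`4κ·c₀K₀ ≤ γ₀δ₁` — print's [B9] (3.42) for the local inverses of the record's complex carrier, x-uniformly ([16] p.272).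

WHAT THIS FILE PROVES (sorry-free): `g3cLocOp_eq_sum_ite` (the operator as a sum over ALL domains of `Y ⊆ Z`-guarded pieces), `weightedRowSum_g3cLocOp_le` ∕ `weightedColSum_g3cLocOp_le`
(`≤ c₀·K₀(64,8)`), `weightedRowSum_g3cLocBlock_sub_le` ∕ `…Col…` (the same for the restricted block, diagonal `x` excluded), ★ `norm_g3cLocInv_apply_le_exp` (Combes–Thomas decay of `G_Z`, x-uniform).

HONEST FRAMING.  Elementary consequences of the HYPOTHESES `P0CarrierClauses …` ∧ `P0CarrierLatticeDecay …` (inhabited nowhere); nothing of Bałaban's estimates asserted, ported or discharged;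
`stub_G3C` NOT closed; 27930 OPEN; NODE O 0∕1; COUNT 8∕28 · K 1∕4 UNMOVED; finite `𝕋⁴_{L^K}` at fixed ε — NOT continuum ∕ OS ∕ Clay; **the Yang–Mills mass gap is NOT proved by any of this.**
No `sorry`, no `instance`, no `notation`, no `def`; standard axioms.
-/

noncomputable section

open scoped BigOperators Matrix.Norms.L2Operator Topology Matrix Classical
open Filter Finset

namespace Summit.QuantumFields.YangMills.Theorems.BalabanUVNodesPortS1

open Summit.QuantumFields.YangMills.Theorems.K0RecordFormatNames
open Literature.MathematicalPhysics.QuantumFieldTheory.Balaban1983to89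
open Literature.MathematicalPhysics.QuantumFieldTheory.Balaban1983to89.Node00
open Literature.MathematicalPhysics.QuantumFieldTheory.Balaban1983to89.T4Continuum (T4Family)
open Literature.MathematicalPhysics.QuantumFieldTheory.Balaban1983to89.TreeLengthTorus (TPt tsys tcubeSys torusTreeLen tsys_dj)
open Literature.MathematicalPhysics.QuantumFieldTheory.Balaban1983to89.B12TreeDecay (K₀ kappa₀)
open Literature.MathematicalPhysics.QuantumFieldTheory.Balaban1983to89.B3Taylor310LocalRemainder (tdist_self tdist_comm tdist_triangle)
open Literature.MathematicalPhysics.QuantumFieldTheory.Balaban1983to89.B5Prop11Lower (nsq nsq_nonneg)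

section Bounds

variable {F : T4Family}
variable {a₀ δ₀ c₀ γ₀ γ₁ δ₁ : ℝ} {Mc : ℕ} {α₀ α₁ ε₂₉ : ℝ} {k : ℕ}
variable {TC : (n : ℕ) → Sect2.CPair (F.P (recordK₀ F Mc k + n)) (MatA 2) → FluctIdx F k (recordK₀ F Mc k + n) → FluctIdx F k (recordK₀ F Mc k + n) → ℂ}
variable {TY : (n : ℕ) → (recordDomSys F Mc k (recordK₀ F Mc k + n)).Dom → Sect2.CPair (F.P (recordK₀ F Mc k + n)) (MatA 2) →
  FluctIdx F k (recordK₀ F Mc k + n) → FluctIdx F k (recordK₀ F Mc k + n) → ℂ}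
variable {TZY : Finset (Fin 4 → ℤ) → IntBondCfg → ((Fin 4 → ℤ) × Fin 4) × Fin 3 → ((Fin 4 → ℤ) × Fin 4) × Fin 3 → ℂ}
variable {AdM : (n : ℕ) → (Site (F.P (recordK₀ F Mc k + n)) 0 → (MatA 2)ˣ) →
  Matrix (FluctIdx F k (recordK₀ F Mc k + n)) (FluctIdx F k (recordK₀ F Mc k + n)) ℂ}
variable {AdZ : ((Fin 4 → ℤ) → (MatA 2)ˣ) → (Fin 4 → ℤ) × Fin 4 → Matrix (Fin 3) (Fin 3) ℂ}

/-- `T^{(Z)}(φ)` as a sum over ALL domains of the `Y ⊆ Z`-guarded pieces on the non-`b₀` index. [cite: Balaban1987RG1, (1.7) p.261 (bookkeeping)] -/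
theorem g3cLocOp_eq_sum_ite (Mc k K : ℕ) (TYK : (recordDomSys F Mc k K).Dom → Sect2.CPair (F.P K) (MatA 2) → FluctIdx F k K → FluctIdx F k K → ℂ)
    (Z : (recordDomSys F Mc k K).Dom) (φ : Sect2.CPair (F.P K) (MatA 2)) :
    g3cLocOp F Mc k K TYK Z φ = ∑ Y ∈ (Finset.univ : Finset (recordDomSys F Mc k K).Dom),
      (if Y.1 ⊆ Z.1 then (Matrix.of fun i j : NonB0Idx F k K => TYK Y φ i.1 j.1) else 0) := by
  ext i j
  rw [g3cLocOp, Matrix.of_apply, Matrix.sum_apply, Finset.sum_filter]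
  refine Finset.sum_congr rfl fun Y _ => ?_
  split_ifs <;> rfl

/-- A weighted sum of norms over the non-`b₀` sub-index is at most the same sum over all fluctuation indices. [folklore] -/
theorem sum_nonB0_le_sum_fluct (k K : ℕ) (f : FluctIdx F k K → ℝ) (hf : ∀ j, 0 ≤ f j) :
    ∑ j : NonB0Idx F k K, f j.1 ≤ ∑ j : FluctIdx F k K, f j := by
  rw [← Fintype.sum_subtype_add_sum_subtype (fun i : FluctIdx F k K => i.1 ∉ Set.range (recordB0 F k K)) f]
  exact le_add_of_nonneg_right (Finset.sum_nonneg fun j _ => hf j)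

/-- ★ **WEIGHTED SCHUR ROW SUMS of `T^{(Z)}(φ)`** at a pair of the record space of `Z`, under (P4) + (P4-lat) with `δ₀ ≥ kappa₀(64, 8)`:
`Σ_j ‖T^{(Z)}(φ) i j‖·e^{δ₁·tdist(i,j)} ≤ c₀·K₀(64, 8)` — uniformly in `Z`, the volume and `k`. [cite: Balaban1988RG2Cluster, (1.26) p.8; Balaban1985BackgroundPropagators, (3.42) p.399] -/
theorem weightedRowSum_g3cLocOp_le (hP : P0CarrierClauses F a₀ δ₀ c₀ γ₀ γ₁ Mc α₀ α₁ ε₂₉ k TC TY TZY AdM AdZ)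
    (hL : P0CarrierLatticeDecay F δ₀ c₀ δ₁ Mc α₀ α₁ k TY) (hMc : McGuard F Mc) (hc₀ : 0 ≤ c₀) (hδ₀ : kappa₀ (4 * 2 ^ 4) (2 * 4) ≤ δ₀) (n : ℕ)
    (Z : (recordDomSys F Mc k (recordK₀ F Mc k + n)).Dom) {φ : Sect2.CPair (F.P (recordK₀ F Mc k + n)) (MatA 2)}
    (hφ : encodeCfg F (recordK₀ F Mc k + n) φ ∈ recordUc F Mc k α₀ α₁ (recordK₀ F Mc k + n) Z) (i : NonB0Idx F k (recordK₀ F Mc k + n)) :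
    ∑ j : NonB0Idx F k (recordK₀ F Mc k + n), ‖g3cLocOp F Mc k (recordK₀ F Mc k + n) (TY n) Z φ i j‖ *
        Real.exp (δ₁ * (Site.tdist i.1.1.src j.1.1.src : ℝ)) ≤ c₀ * K₀ (4 * 2 ^ 4) (2 * 4) := by
  obtain ⟨-, -, -, -, -, -, -, -, hSupp, -⟩ := hP
  have hK : recordK₀ F Mc k ≤ recordK₀ F Mc k + n := Nat.le_add_right _ _
  rw [g3cLocOp_eq_sum_ite]
  refine G3CGeom.weightedRowSum_sum_pieces_le (d := (F.P (recordK₀ F Mc k + n)).d)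
    (fun s : NonB0Idx F k (recordK₀ F Mc k + n) => cubeOfSite F Mc k (recordK₀ F Mc k + n) (blockOf s.1.1.src))
    (fun Y => if Y.1 ⊆ Z.1 then (Matrix.of fun i j : NonB0Idx F k (recordK₀ F Mc k + n) => TY n Y φ i.1 j.1) else 0)
    (fun Y s s' hs => ?_) (fun i j => Real.exp (δ₁ * (Site.tdist i.1.1.src j.1.1.src : ℝ))) (fun _ _ => (Real.exp_pos _).le) hc₀ hδ₀
    (fun Y s => ?_) Finset.univ i
  · -- support in the row index, cube form
    split_ifs with hY
    · exact fluct_supp_of_cube hMc hK (hSupp n) Y φ s s' (Or.inl hs)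
    · rfl
  · -- the weighted row bound of each guarded piece
    split_ifs with hY
    · have hφY : encodeCfg F (recordK₀ F Mc k + n) φ ∈ recordUc F Mc k α₀ α₁ (recordK₀ F Mc k + n) Y := recordUc_antitone F hY hφ
      have h := (hL n Y φ hφY).1 s.1
      refine le_trans ?_ h
      simpa only [Matrix.of_apply] using
        sum_nonB0_le_sum_fluct k (recordK₀ F Mc k + n) (fun j => ‖TY n Y φ s.1 j‖ * Real.exp (δ₁ * (Site.tdist s.1.1.src j.1.src : ℝ)))
          (fun j => by positivity)
    · simp only [Matrix.zero_apply, norm_zero, zero_mul, Finset.sum_const_zero]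
      positivity

/-- ★ **WEIGHTED SCHUR COLUMN SUMS of `T^{(Z)}(φ)`**: `Σ_i ‖T^{(Z)}(φ) i j‖·e^{δ₁·tdist(i,j)} ≤ c₀·K₀(64, 8)`. [cite: Balaban1988RG2Cluster, (1.26) p.8; Balaban1985BackgroundPropagators, (3.42) p.399] -/
theorem weightedColSum_g3cLocOp_le (hP : P0CarrierClauses F a₀ δ₀ c₀ γ₀ γ₁ Mc α₀ α₁ ε₂₉ k TC TY TZY AdM AdZ)
    (hL : P0CarrierLatticeDecay F δ₀ c₀ δ₁ Mc α₀ α₁ k TY) (hMc : McGuard F Mc) (hc₀ : 0 ≤ c₀) (hδ₀ : kappa₀ (4 * 2 ^ 4) (2 * 4) ≤ δ₀) (n : ℕ)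
    (Z : (recordDomSys F Mc k (recordK₀ F Mc k + n)).Dom) {φ : Sect2.CPair (F.P (recordK₀ F Mc k + n)) (MatA 2)}
    (hφ : encodeCfg F (recordK₀ F Mc k + n) φ ∈ recordUc F Mc k α₀ α₁ (recordK₀ F Mc k + n) Z) (j : NonB0Idx F k (recordK₀ F Mc k + n)) :
    ∑ i : NonB0Idx F k (recordK₀ F Mc k + n), ‖g3cLocOp F Mc k (recordK₀ F Mc k + n) (TY n) Z φ i j‖ *
        Real.exp (δ₁ * (Site.tdist i.1.1.src j.1.1.src : ℝ)) ≤ c₀ * K₀ (4 * 2 ^ 4) (2 * 4) := by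
  obtain ⟨-, -, -, -, -, -, -, -, hSupp, -⟩ := hP
  have hK : recordK₀ F Mc k ≤ recordK₀ F Mc k + n := Nat.le_add_right _ _
  rw [g3cLocOp_eq_sum_ite]
  refine G3CGeom.weightedColSum_sum_pieces_le (d := (F.P (recordK₀ F Mc k + n)).d)
    (fun s : NonB0Idx F k (recordK₀ F Mc k + n) => cubeOfSite F Mc k (recordK₀ F Mc k + n) (blockOf s.1.1.src))
    (fun Y => if Y.1 ⊆ Z.1 then (Matrix.of fun i j : NonB0Idx F k (recordK₀ F Mc k + n) => TY n Y φ i.1 j.1) else 0)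
    (fun Y s s' hs' => ?_) (fun i j => Real.exp (δ₁ * (Site.tdist i.1.1.src j.1.1.src : ℝ))) (fun _ _ => (Real.exp_pos _).le) hc₀ hδ₀
    (fun Y s' => ?_) Finset.univ j
  · split_ifs with hY
    · exact fluct_supp_of_cube hMc hK (hSupp n) Y φ s s' (Or.inr hs')
    · rfl
  · split_ifs with hY
    · have hφY : encodeCfg F (recordK₀ F Mc k + n) φ ∈ recordUc F Mc k α₀ α₁ (recordK₀ F Mc k + n) Y := recordUc_antitone F hY hφ
      have h := (hL n Y φ hφY).2 s'.1
      refine le_trans ?_ h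
      simpa only [Matrix.of_apply] using
        sum_nonB0_le_sum_fluct k (recordK₀ F Mc k + n) (fun i => ‖TY n Y φ i s'.1‖ * Real.exp (δ₁ * (Site.tdist i.1.src s'.1.1.src : ℝ)))
          (fun i => by positivity)
    · simp only [Matrix.zero_apply, norm_zero, zero_mul, Finset.sum_const_zero]
      positivity

/-- Weighted Schur ROW sums of the restricted block `T^{(Z)}(φ)|_Z` (a sub-sum of the above). [folklore] -/
theorem weightedRowSum_g3cLocOp_sub_le (hP : P0CarrierClauses F a₀ δ₀ c₀ γ₀ γ₁ Mc α₀ α₁ ε₂₉ k TC TY TZY AdM AdZ)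
    (hL : P0CarrierLatticeDecay F δ₀ c₀ δ₁ Mc α₀ α₁ k TY) (hMc : McGuard F Mc) (hc₀ : 0 ≤ c₀) (hδ₀ : kappa₀ (4 * 2 ^ 4) (2 * 4) ≤ δ₀) (n : ℕ)
    (Z : (recordDomSys F Mc k (recordK₀ F Mc k + n)).Dom) {φ : Sect2.CPair (F.P (recordK₀ F Mc k + n)) (MatA 2)}
    (hφ : encodeCfg F (recordK₀ F Mc k + n) φ ∈ recordUc F Mc k α₀ α₁ (recordK₀ F Mc k + n) Z)
    (i : {i : NonB0Idx F k (recordK₀ F Mc k + n) // g3cInDom F Mc k (recordK₀ F Mc k + n) Z i}) :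
    ∑ j : {i : NonB0Idx F k (recordK₀ F Mc k + n) // g3cInDom F Mc k (recordK₀ F Mc k + n) Z i},
      ‖(g3cLocOp F Mc k (recordK₀ F Mc k + n) (TY n) Z φ).submatrix Subtype.val Subtype.val i j‖ *
        Real.exp (δ₁ * (Site.tdist i.1.1.1.src j.1.1.1.src : ℝ)) ≤ c₀ * K₀ (4 * 2 ^ 4) (2 * 4) := by
  refine le_trans ?_ (weightedRowSum_g3cLocOp_le hP hL hMc hc₀ hδ₀ n Z hφ i.1)
  rw [← Fintype.sum_subtype_add_sum_subtype (fun j : NonB0Idx F k (recordK₀ F Mc k + n) => g3cInDom F Mc k (recordK₀ F Mc k + n) Z j)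
    (fun j => ‖g3cLocOp F Mc k (recordK₀ F Mc k + n) (TY n) Z φ i.1 j‖ * Real.exp (δ₁ * (Site.tdist i.1.1.1.src j.1.1.src : ℝ)))]
  exact le_add_of_nonneg_right (Finset.sum_nonneg fun j _ => by positivity)

/-- Weighted Schur COLUMN sums of the restricted block `T^{(Z)}(φ)|_Z`. [folklore] -/
theorem weightedColSum_g3cLocOp_sub_le (hP : P0CarrierClauses F a₀ δ₀ c₀ γ₀ γ₁ Mc α₀ α₁ ε₂₉ k TC TY TZY AdM AdZ)
    (hL : P0CarrierLatticeDecay F δ₀ c₀ δ₁ Mc α₀ α₁ k TY) (hMc : McGuard F Mc) (hc₀ : 0 ≤ c₀) (hδ₀ : kappa₀ (4 * 2 ^ 4) (2 * 4) ≤ δ₀) (n : ℕ)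
    (Z : (recordDomSys F Mc k (recordK₀ F Mc k + n)).Dom) {φ : Sect2.CPair (F.P (recordK₀ F Mc k + n)) (MatA 2)}
    (hφ : encodeCfg F (recordK₀ F Mc k + n) φ ∈ recordUc F Mc k α₀ α₁ (recordK₀ F Mc k + n) Z)
    (j : {i : NonB0Idx F k (recordK₀ F Mc k + n) // g3cInDom F Mc k (recordK₀ F Mc k + n) Z i}) :
    ∑ i : {i : NonB0Idx F k (recordK₀ F Mc k + n) // g3cInDom F Mc k (recordK₀ F Mc k + n) Z i},
      ‖(g3cLocOp F Mc k (recordK₀ F Mc k + n) (TY n) Z φ).submatrix Subtype.val Subtype.val i j‖ *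
        Real.exp (δ₁ * (Site.tdist i.1.1.1.src j.1.1.1.src : ℝ)) ≤ c₀ * K₀ (4 * 2 ^ 4) (2 * 4) := by
  refine le_trans ?_ (weightedColSum_g3cLocOp_le hP hL hMc hc₀ hδ₀ n Z hφ j.1)
  rw [← Fintype.sum_subtype_add_sum_subtype (fun i : NonB0Idx F k (recordK₀ F Mc k + n) => g3cInDom F Mc k (recordK₀ F Mc k + n) Z i)
    (fun i => ‖g3cLocOp F Mc k (recordK₀ F Mc k + n) (TY n) Z φ i j.1‖ * Real.exp (δ₁ * (Site.tdist i.1.1.src j.1.1.1.src : ℝ)))]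
  exact le_add_of_nonneg_right (Finset.sum_nonneg fun i _ => by positivity)

/-- ★★ **LATTICE-SCALE COMBES–THOMAS DECAY OF THE LOCAL INVERSE, x-UNIFORM** ([B9] (3.42) at the record's complex carrier; «G̃₃(x) has the same properties as G̃₂», [16] p.272): under the P0-ℂ body,
(P4-lat) with `δ₀ ≥ kappa₀(64,8)`, and a rate `κ` with `0 ≤ κ`, `2κ ≤ δ₁`, `4κ·(c₀K₀(64,8)) ≤ γ₀δ₁`, for every `x ≥ 0` and every pair `φ` of the record space of `Z`:
`‖G_Z(x, φ) i j‖ ≤ e^{−κ·tdist(i,j)}/(γ₀/2)`. [cite: Balaban1985BackgroundPropagators, (3.42) p.399; Balaban1985UV3, p.272 (after (63)); Balaban1987RG1, (1.18) p.263] -/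
theorem norm_g3cLocInv_apply_le_exp (hP : P0CarrierClauses F a₀ δ₀ c₀ γ₀ γ₁ Mc α₀ α₁ ε₂₉ k TC TY TZY AdM AdZ)
    (hL : P0CarrierLatticeDecay F δ₀ c₀ δ₁ Mc α₀ α₁ k TY) (hMc : McGuard F Mc) (hc₀ : 0 ≤ c₀) (hγ₀ : 0 < γ₀) (hδ₁ : 0 < δ₁)
    (hδ₀ : kappa₀ (4 * 2 ^ 4) (2 * 4) ≤ δ₀) {κ : ℝ} (hκ : 0 ≤ κ) (hκδ : 2 * κ ≤ δ₁) (hκc : 4 * κ * (c₀ * K₀ (4 * 2 ^ 4) (2 * 4)) ≤ γ₀ * δ₁) (n : ℕ)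
    (Z : (recordDomSys F Mc k (recordK₀ F Mc k + n)).Dom) {φ : Sect2.CPair (F.P (recordK₀ F Mc k + n)) (MatA 2)}
    (hφ : encodeCfg F (recordK₀ F Mc k + n) φ ∈ recordUc F Mc k α₀ α₁ (recordK₀ F Mc k + n) Z) {x : ℝ} (hx : 0 ≤ x)
    (i j : NonB0Idx F k (recordK₀ F Mc k + n)) :
    ‖g3cLocInv F Mc k (recordK₀ F Mc k + n) (TY n) Z x φ i j‖ ≤ Real.exp (-(κ * (Site.tdist i.1.1.src j.1.1.src : ℝ))) / (γ₀ / 2) := by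
  by_cases hi : g3cInDom F Mc k (recordK₀ F Mc k + n) Z i
  · by_cases hj : g3cInDom F Mc k (recordK₀ F Mc k + n) Z j
    · rw [g3cLocInv_apply_of_mem Mc k _ (TY n) Z x φ hi hj, g3cLocBlock]
      exact G3CCT.norm_resolvent_apply_le_of_weightedSchur _
        (fun a b : {i : NonB0Idx F k (recordK₀ F Mc k + n) // g3cInDom F Mc k (recordK₀ F Mc k + n) Z i} => (Site.tdist a.1.1.1.src b.1.1.1.src : ℝ))
        (fun a => by exact_mod_cast tdist_self _) (fun a b => by exact_mod_cast Nat.zero_le _)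
        (fun a b => by exact_mod_cast tdist_comm _ _) (fun a b c => by exact_mod_cast tdist_triangle _ _ _)
        hγ₀ hδ₁ hκ hκδ hκc (g3cLocBlock_reCoercive hP n Z hφ)
        (weightedRowSum_g3cLocOp_sub_le hP hL hMc hc₀ hδ₀ n Z hφ) (weightedColSum_g3cLocOp_sub_le hP hL hMc hc₀ hδ₀ n Z hφ) hx ⟨i, hi⟩ ⟨j, hj⟩
    · rw [g3cLocInv_apply_of_not_mem Mc k _ (TY n) Z x φ (Or.inr hj), norm_zero]; positivity
  · rw [g3cLocInv_apply_of_not_mem Mc k _ (TY n) Z x φ (Or.inl hi), norm_zero]; positivity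

end Bounds

end Summit.QuantumFields.YangMills.Theorems.BalabanUVNodesPortS1

end
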